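import Mathlib
import Summits.ValiantsHypothesis.ValiantsHypothesis.Theses.LacunarySymmetroid
import Summits.ValiantsHypothesis.ValiantsHypothesis.Theorems.LacunarySymmetroidPencilTransfer
import Summits.ValiantsHypothesis.ValiantsHypothesis.Theorems.LacunarySymmetroidMatrixDescartesCensusDefs
import Summits.ValiantsHypothesis.ValiantsHypothesis.Theorems.LacunarySymmetroidMatrixDescartesCensusFrame
import Summits.ValiantsHypothesis.ValiantsHypothesis.Theorems.LacunarySymmetroidThetaWitness
import Summits.ValiantsHypothesis.ValiantsHypothesis.Theorems.LacunarySymmetroidMatrixDescartesHyperbolicThetaWitness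
import Summits.ValiantsHypothesis.ValiantsHypothesis.Theorems.MatrixDescartes.Negative.MatrixDescartesHypRootLawAtTwoFour

/-!
# LINE «hyperbolic» — the REAL-ROOTED SECTOR DOOR (val-idea-6 g2, lens «assume the law fails»)

Target decl BY NAME: `_root_.ValiantsHypothesis` through the V1 door of route `LacunarySymmetroid`
(bears_on: stmt-ValiantsHypothesis-18050 `MatrixDescartes`; also `KPlusLogSqLaw` = Conjecture B).

**Observation (read off the tree, not a new theorem).**  The two PROVED items of the V1 door are
sharper than the door uses:
* `thetaWitness_proof`: the VNP witness restricts to `Θ_n(X^{d_n}) = V_ν = tavenasV ν =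
  Σ_{i<2^ν} 2^{2i(2^ν-1-i)} X^i` — a DENSE polynomial ALL of whose `2^ν − 1` roots are REAL and
  SIMPLE (Hutchinson; tree `le_card_roots_toFinset_map_tavenasV`);
* `pencilTransfer_proof` ("descend, don't realify"): the symmetric real lacunary pencil has
  determinant EQUAL to `f_n(X^{d})` as a polynomial (tree `pencilDet_of_affine`), no squaring.

Hence, **if the format-level law fails, only counterexamples whose determinant is real-rooted with
simple roots matter for Valiant's hypothesis**: VH ⟸ `HyperbolicLaw` = `MatrixDescartes` restricted
to the sector `{F : det F has natDegree-many distinct real roots}` (with `q = 2`).  Every census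
monster (towers (0,1,3,20), grafts, softmax designs; all records of pub-symmetroid) has
`natDegree ≫ #real roots`, i.e. lies OUTSIDE this sector by definition; the witness lies inside
by construction.  In the sector `#distinct real roots = natDegree`, so the law is a DEGREE bound,
and the tools of the theory of hyperbolic (real-rooted) polynomials become available: Newton–
Maclaurin inequalities and the gap rule (no two consecutive vanishing coefficients), Aissen–
Schoenberg–Whitney/Edrei total positivity of the coefficient Toeplitz matrix, the Hermite–Hankel
PSD certificate, hyperbolic/definite matrix polynomials and their linearisations
(Higham–Mackey–Tisseur), the Pólya–Schur/Borcea–Brändén preserver semigroup.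

Items (D-0145): H3 `HyperbolicLaw` (crux, the ONLY stub) · H2 `HyperbolicThetaWitness` (PROVED v2 via the
parametric `masterWitness`; LANDED in Theorems by hw1, p595331 — cited by name in v3) ·
H1 `HyperbolicTransfer` (PROVED below from the tree's PencilTransfer lemmas) · kernel glue
`valiant_of_hyperbolicLaw` (PROVED) · `hyperbolicLaw_of_matrixDescartes` (PROVED: H3 is WEAKER
than the V1 crux) · format rows `HypRootLawAt` (rungs K ≤ 2 and the Descartes transfer PROVED); the v1 LINEAR
row `HyperbolicLinearLaw` is REFUTED at (2,4) (crit-1's witness, landed Negative p595372: `not_hyperbolicLinearLaw`);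
replacement instrument question = sector-fullness η(m,K) = M(m,K)? (crit-2), this seat's bet: full at m = 2.
VP ≠ VNP is not moved by this line: it re-targets the open law to a thinner sector, nothing more.
-/

set_option linter.dupNamespace false
set_option maxHeartbeats 800000

noncomputable section

namespace Summit.ValiantsHypothesis.ValiantsHypothesis.Theses.LacunarySymmetroid.HyperbolicLine

open scoped BigOperators Polynomial
open Summit.ValiantsHypothesis.ValiantsHypothesis.Theses.LacunarySymmetroid
  (MatrixDescartes PencilTransfer ThetaWitness)
open Summit.ValiantsHypothesis.ValiantsHypothesis.Theorems.LacunarySymmetroidMatrixDescartes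
  (RealRootLawAt KPlusLogSqLaw)
open Literature.Computability.AlgebraicComplexity

/-- The lacunary symmetric pencil `F_{d,S}(X) = Σ_l X^{d l} S_l` as a polynomial matrix (census currency). -/
abbrev pencil {m K : ℕ} (d : Fin K → ℕ) (S : Fin K → Matrix (Fin m) (Fin m) ℝ) :
    Matrix (Fin m) (Fin m) ℝ[X] :=
  ∑ l, ((Polynomial.X : ℝ[X]) ^ d l) • (S l).map Polynomial.C

/-- **The sector.** `IsRealRootedSimple p`: `p` has `natDegree p` distinct real roots, i.e. `p` splits over `ℝ`
with simple roots (`p = 0` and constants qualify vacuously: no roots, degree 0). -/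
def IsRealRootedSimple (p : ℝ[X]) : Prop := p.roots.toFinset.card = p.natDegree

/-- **Format row of the sector** («`η(m,K) ≤ B`»): every real symmetric `(m,K)` lacunary pencil whose determinant
is real-rooted with simple roots has determinant of degree `≤ B` (in the sector, degree = number of real roots). -/
def HypRootLawAt (m K B : ℕ) : Prop :=
  ∀ (d : Fin K → ℕ) (S : Fin K → Matrix (Fin m) (Fin m) ℝ), (∀ l, (S l).IsSymm) →
    IsRealRootedSimple (pencil d S).det → (pencil d S).det.natDegree ≤ B

/-- **H3 — the crux of the line (the weakest law this door needs).**  `MatrixDescartes` restricted to the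
real-rooted-simple sector, at the single exponent `q = 2`: for quasi-polynomial formats, a real symmetric lacunary
pencil whose determinant has only real, simple roots has `(deg det)^2 ≤ 2^{K ⌊log₂ K⌋}`. -/
def HyperbolicLaw : Prop :=
  ∀ c : ℕ, ∃ K₀ : ℕ, ∀ K m : ℕ, K₀ ≤ K → m ≤ 2 ^ ((Nat.log 2 K + c) ^ c) →
    ∀ (d : Fin K → ℕ) (S : Fin K → Matrix (Fin m) (Fin m) ℝ), (∀ l, (S l).IsSymm) →
      IsRealRootedSimple (pencil d S).det → (pencil d S).det.natDegree ^ 2 ≤ 2 ^ (K * Nat.log 2 K)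

/-- **H1 — det-exact symmetric transfer** (= `PencilTransfer` with its conclusion upgraded from equality of root
finsets to equality of POLYNOMIALS; proved below from the tree's own lemmas). -/
def HyperbolicTransfer : Prop :=
  ∀ (v : ℕ → ℕ) (f : ∀ n, MvPolynomial (Fin (v n)) ℝ),
    IsVPFamily (fun n => MvPolynomial.map (algebraMap ℝ ℂ) (f n)) →
    ∀ d : (n : ℕ) → Fin (v n) → ℕ, ∃ c : ℕ, ∀ n : ℕ, ∃ m : ℕ, m ≤ 2 ^ ((Nat.log 2 n + c) ^ c) ∧
      ∃ S : Fin (v n + 1) → Matrix (Fin m) (Fin m) ℝ, (∀ l, (S l).IsSymm) ∧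
        (pencil (Fin.cons (α := fun _ => ℕ) (0 : ℕ) (d n)) S).det =
          MvPolynomial.aeval (fun i => (Polynomial.X : ℝ[X]) ^ d n i) (f n)

/-- **H2 — the witness lands in the sector**: a VNP family whose restriction to a monomial curve is real-rooted with
simple roots and has `≥ 2^{n⌊log₂ n⌋} − 1` of them (the tree's witness `Θ_n(X^{2^{βi}}) = tavenasV ν` does:
dense, Hutchinson). -/
def HyperbolicThetaWitness : Prop :=
  ∃ (Θ : ∀ n : ℕ, MvPolynomial (Fin n) ℝ) (d : ∀ n : ℕ, Fin n → ℕ),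
    IsVNPFamily (fun n => MvPolynomial.map (algebraMap ℝ ℂ) (Θ n)) ∧
    ∃ n₀ : ℕ, ∀ n : ℕ, n₀ ≤ n →
      IsRealRootedSimple (MvPolynomial.aeval (fun i => (Polynomial.X : ℝ[X]) ^ d n i) (Θ n)) ∧
      2 ^ (n * Nat.log 2 n) ≤
        (MvPolynomial.aeval (fun i => (Polynomial.X : ℝ[X]) ^ d n i) (Θ n)).natDegree + 1

/-! ## Registered obligations (stubs) -/

/-- OBLIGATION H3 (the crux of the line; OPEN). -/
theorem stub_hyperbolicLaw : HyperbolicLaw := by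
  sorry

/-! ## H2 PROVED: the witness lies in the sector (v2 in this workfile; LANDED in Theorems by val-width-18050-hw1, p595331)

The tree's Tavenas witness with the digit base as a parameter `a` restricts along the monomial curve to
`tavenasV (a·n⌊log₂n⌋)` AS A POLYNOMIAL (`Hyperbolic.exists_thetaPow`, = this seat's `masterWitness`), and `tavenasV ν`
has `2^ν − 1` distinct real roots `=` its degree (`Hyperbolic.card_roots_toFinset_eq_natDegree_map_tavenasV`). -/

/-- `tavenasV ν` (over `ℝ`) lies in the real-rooted-simple sector (tree, hw1). -/
theorem isRealRootedSimple_map_tavenasV (ν : ℕ) :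
    IsRealRootedSimple ((tavenasV ν).map (Int.castRingHom ℝ)) :=
  Summit.ValiantsHypothesis.ValiantsHypothesis.Theorems.LacunarySymmetroidMatrixDescartes.Hyperbolic.card_roots_toFinset_eq_natDegree_map_tavenasV ν

/-- **OBLIGATION H2 — PROVED** (v2 here via `masterWitness 1`; v3 cites the landed Theorems decl
`LacunarySymmetroidMatrixDescartes.Hyperbolic.hyperbolicThetaWitness`, p595331). -/
theorem hyperbolicThetaWitness_proof : HyperbolicThetaWitness :=
  Summit.ValiantsHypothesis.ValiantsHypothesis.Theorems.LacunarySymmetroidMatrixDescartes.Hyperbolic.hyperbolicThetaWitness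

/-! ## Proved: H1, the kernel glue, and `MatrixDescartes ⇒ H3` -/

/-- **H1 PROVED** from the tree (`symmAffineRepr_of_isVPFamily_complex`, `pencilDet_of_affine`,
`pencilTransfer_size_bound` of `…Theorems.LacunarySymmetroid`): the transfer is det-exact. -/
theorem hyperbolicTransfer_proof : HyperbolicTransfer := by
  intro v f hf d
  obtain ⟨⟨c₀, hc₀⟩, hrep⟩ :=
    Summit.ValiantsHypothesis.ValiantsHypothesis.Theorems.LacunarySymmetroid.symmAffineRepr_of_isVPFamily_complex
      v f hf
  refine ⟨c₀ + 11, fun n => ?_⟩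
  obtain ⟨B, hsymm, hB⟩ := hrep n
  refine ⟨4 * determinantalComplexity (f n) ^ 3 + 7,
    Summit.ValiantsHypothesis.ValiantsHypothesis.Theorems.LacunarySymmetroid.pencilTransfer_size_bound (hc₀ n),
    Fin.cons (α := fun _ => Matrix (Fin (4 * determinantalComplexity (f n) ^ 3 + 7))
      (Fin (4 * determinantalComplexity (f n) ^ 3 + 7)) ℝ) (constPart B) (fun i => LRPencil.coeffMat B i),
    ?_, ?_⟩
  · refine Fin.cases ?_ (fun i => ?_)
    · rw [Fin.cons_zero]; exact hsymm.map _
    · rw [Fin.cons_succ]; exact hsymm.map _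
  · rw [Summit.ValiantsHypothesis.ValiantsHypothesis.Theorems.LacunarySymmetroid.pencilDet_of_affine B hB.1 (d n),
      hB.2]

/-- **`MatrixDescartes ⇒ HyperbolicLaw`** (instantiate `q = 2`; in the sector the root count is the degree):
the line's crux is WEAKER than the V1 crux. -/
theorem hyperbolicLaw_of_matrixDescartes (h : MatrixDescartes) : HyperbolicLaw := by
  intro c
  obtain ⟨K₀, hK⟩ := h c 2 (by norm_num)
  refine ⟨K₀, fun K m hK₀ hm d S hS hrr => ?_⟩
  have h1 := hK K m hK₀ hm d S hS
  unfold IsRealRootedSimple at hrr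
  rw [hrr] at h1
  exact h1

/-- **THE DECIDING GLUE (kernel-checked): the real-rooted sector door.**
`HyperbolicLaw → HyperbolicTransfer → HyperbolicThetaWitness → ValiantsHypothesis`
(copy of the route's `closes` with `q = 2`, the law invoked only on the witness's real-rooted-simple determinant). -/
theorem valiant_of_hyperbolicLaw (hH : HyperbolicLaw) (hT : HyperbolicTransfer)
    (hW : HyperbolicThetaWitness) : _root_.ValiantsHypothesis := by
  show Literature.Computability.AlgebraicComplexity.VP ℂ ≠ Literature.Computability.AlgebraicComplexity.VNP ℂ
  intro hEq
  obtain ⟨Θ, d, hVNP, n₀, hwit⟩ := hW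
  have hVP : Literature.Computability.AlgebraicComplexity.IsVPFamily
      (fun n => MvPolynomial.map (algebraMap ℝ ℂ) (Θ n)) := by
    have hmem := (Literature.Computability.AlgebraicComplexity.mem_VNP_ofFintype_iff_holds _).2 hVNP
    rw [← hEq] at hmem
    exact (Literature.Computability.AlgebraicComplexity.mem_VP_ofFintype_iff_holds _).1 hmem
  obtain ⟨c, hc⟩ := hT (fun n => n) Θ hVP d
  obtain ⟨K₀, hK⟩ := hH c
  obtain ⟨n, hn₀, hnK, hn8⟩ : ∃ n, n₀ ≤ n ∧ K₀ ≤ n ∧ 8 ≤ n := ⟨n₀ + K₀ + 8, by omega, by omega, by omega⟩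
  obtain ⟨m, hm, S, hS, hdet⟩ := hc n
  obtain ⟨hrr, h2⟩ := hwit n hn₀
  set Z := (MvPolynomial.aeval (fun i => (Polynomial.X : Polynomial ℝ) ^ d n i) (Θ n)).natDegree with hZ
  have hm' : m ≤ 2 ^ ((Nat.log 2 (n + 1) + c) ^ c) :=
    hm.trans (Nat.pow_le_pow_right (by norm_num)
      (Nat.pow_le_pow_left (Nat.add_le_add_right (Nat.log_mono_right (Nat.le_succ n)) c) c))
  have hrr' : IsRealRootedSimple (pencil (Fin.cons (α := fun _ => ℕ) (0 : ℕ) (d n)) S).det := by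
    rw [hdet]; exact hrr
  have h1 := hK (n + 1) m (by omega) hm' (Fin.cons (α := fun _ => ℕ) (0 : ℕ) (d n)) S hS hrr'
  rw [hdet] at h1
  set L := Nat.log 2 n with hL
  have hL3 : 3 ≤ L := by
    rw [hL]
    calc 3 = Nat.log 2 8 := by decide
      _ ≤ Nat.log 2 n := Nat.log_mono_right hn8
  have hLn : L ≤ n := by rw [hL]; exact Nat.log_le_self 2 n
  have hL' : Nat.log 2 (n + 1) ≤ L + 1 := by
    rw [hL]
    calc Nat.log 2 (n + 1) ≤ Nat.log 2 (n * 2) := Nat.log_mono_right (by omega)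
      _ = Nat.log 2 n + 1 := Nat.log_mul_base (by norm_num) (by omega)
  have h3 : Z ^ 2 ≤ 2 ^ ((n + 1) * (L + 1)) :=
    h1.trans (Nat.pow_le_pow_right (by norm_num) (Nat.mul_le_mul_left _ hL'))
  have hnL : 1 ≤ n * L := by nlinarith
  have h4 : 2 ^ (n * L - 1) ≤ Z := by
    have e : 2 ^ (n * L) = 2 * 2 ^ (n * L - 1) := by
      rw [← Nat.pow_succ']
      congr 1
      omega
    have h2' := h2
    rw [e] at h2'
    have : 1 ≤ 2 ^ (n * L - 1) := Nat.one_le_two_pow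
    omega
  have h5 : 2 ^ (2 * (n * L - 1)) ≤ Z ^ 2 := by
    rw [pow_mul']
    exact Nat.pow_le_pow_left h4 2
  have h6 : 2 * (n * L - 1) ≤ (n + 1) * (L + 1) :=
    (Nat.pow_le_pow_iff_right (by norm_num)).1 (h5.trans h3)
  have h7 : 3 * n ≤ n * L := by nlinarith
  have h6' : 2 * (n * L - 1) ≤ n * L + n + L + 1 := by
    have e : (n + 1) * (L + 1) = n * L + n + L + 1 := by ring
    rw [e] at h6
    exact h6
  generalize hP : n * L = P at h6' h7 hnL
  omega

/-- **Composition to the EXISTING target by name**: the two stubs + the proved transfer give `ValiantsHypothesis`. -/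
theorem valiantsHypothesis_of_stubs : _root_.ValiantsHypothesis :=
  valiant_of_hyperbolicLaw stub_hyperbolicLaw hyperbolicTransfer_proof hyperbolicThetaWitness_proof

/-! ## Format rows: the sector's census currency, first rungs, the linear conjecture row -/

/-- A format law in the sector implies the door law whenever its bound is `2^{o(K log K)}` on qp formats; the
Conjecture-B-shaped instance. -/
def HyperbolicB : Prop := ∃ C : ℕ, ∀ m K : ℕ, HypRootLawAt m K (2 ^ (C * (K + Nat.log 2 m ^ 2)))

/-- Conjecture B restricted to the sector is implied by Conjecture B (in the sector the count is the degree). -/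
theorem hyperbolicB_of_kPlusLogSqLaw (h : KPlusLogSqLaw) : HyperbolicB := by
  obtain ⟨C, hC⟩ := h
  refine ⟨C, fun m K d S hS hrr => ?_⟩
  have h1 := hC m K d S hS
  unfold IsRealRootedSimple at hrr
  rw [hrr] at h1
  exact h1

/-- **THE LINEAR ROW — REFUTED (2026-08-28, val-idea-crit-1; landed by hw1 as
`Theorems/MatrixDescartes/Negative/MatrixDescartesHypRootLawAtTwoFour.lean`, p595372).**  The v1 instrument row
«`η(m,K) ≤ 2m(K−1)+1`» holds for `K ≤ 2` (`hyperbolicLinearLaw_of_le_two`) and at `(2,3)` (`η(2,3) = 8`, parity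
argument in the card) but FAILS at the director's falsifier cell `(2,4)`: `d = (0,2,5,7)`, all four `S_l` indefinite,
`det` squarefree of degree 14 with exactly 14 real roots (8 positive, 6 negative) ⇒ `η(2,4) ≥ 14 > 13`
(`Negative.not_hypRootLawAt_two_four_13`).  Kept as a `def` (settled negative edge); its stub is deleted. -/
def HyperbolicLinearLaw : Prop := ∀ m K : ℕ, HypRootLawAt m K (2 * m * (K - 1) + 1)

/-- The linear row is false (instance `(2,4)`; tree `Negative.not_hyperbolicLinearLaw`, unfolded there, folded here). -/
theorem not_hyperbolicLinearLaw : ¬ HyperbolicLinearLaw := fun h =>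
  Summit.ValiantsHypothesis.ValiantsHypothesis.Theorems.MatrixDescartes.Negative.not_hyperbolicLinearLaw fun m K d S hS hrr => h m K d S hS hrr

/-- `η(2,4) ≥ 14`: the sector is FULL at `(2,4)` (`14 = M_loc(2,4)`, crit-2's scan).  REPLACEMENT INSTRUMENT QUESTION
(crit-2): SECTOR-FULLNESS «`η(m,K) = M(m,K)`?» at the fat cells `(2,5)` [18], `(3,3)` [13], `(3,4)` [34].
THIS SEAT'S BET (asked for by crit-2): FULL at `m = 2` for every `K` (crit-1's Lorentz model: for `2×2` symmetric
pencils real-rootedness is a convexity condition on the tropical profile, realisable by all-indefinite coefficient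
tuples) and probably full at `(3,3)`; i.e. NO located slack is claimed for H3 — at census scale H3 is MDR re-clothed
for counting, and the door's content is the TOOLSET available at quasi-polynomial scale (Newton/Maclaurin,
Hermite–Biehler/Obreschkoff, interlacing, definite linearisations), exactly as the honest framing of v1 said. -/
theorem not_hypRootLawAt_two_four_13 : ¬ HypRootLawAt 2 4 13 := fun h =>
  Summit.ValiantsHypothesis.ValiantsHypothesis.Theorems.MatrixDescartes.Negative.not_hypRootLawAt_two_four_13 fun d S hS hrr => h d S hS hrr

/-- Rung `K = 0`: the empty pencil is the zero matrix; its determinant is `0` or `1`, degree `0`. -/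
theorem hypRootLawAt_zero (m B : ℕ) : HypRootLawAt m 0 B := by
  intro d S hS _
  have h : (pencil d S) = 0 := by
    simp [pencil]
  rw [h]
  rcases Nat.eq_zero_or_pos m with hm | hm
  · subst hm
    simp
  · haveI : Nonempty (Fin m) := ⟨⟨0, hm⟩⟩
    rw [Matrix.det_zero]
    simp

/-! ## Rungs of the rows (PROVED, v2): every census row transfers to the sector; the linear row holds for `K ≤ 2` -/

/-- Any unrestricted real-root row is a sector row (in the sector, `#roots = natDegree`). -/
theorem hypRootLawAt_of_realRootLawAt {m K B : ℕ} (h : RealRootLawAt m K B) : HypRootLawAt m K B := by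
  intro d S hS hrr
  have h1 := h d S hS
  unfold IsRealRootedSimple at hrr
  rw [hrr] at h1
  exact h1

theorem hypRootLawAt_mono {m K B B' : ℕ} (h : HypRootLawAt m K B) (hB : B ≤ B') : HypRootLawAt m K B' :=
  fun d S hS hrr => (h d S hS hrr).trans hB

/-- Descartes row in the sector: `η(m,K) ≤ 2·C(m+K−1,m) − 1` (tree `Census.realRootLawAt_descartes`). -/
theorem hypRootLawAt_descartes (m K : ℕ) (hK : 0 < K) :
    HypRootLawAt m K (2 * Nat.choose (m + K - 1) m - 1) :=
  hypRootLawAt_of_realRootLawAt (Summit.ValiantsHypothesis.ValiantsHypothesis.Theorems.LacunarySymmetroidMatrixDescartes.Census.realRootLawAt_descartes m K hK)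

/-- **The linear row holds for `K ≤ 2`** (all `m`): `K = 0` (`det 0`), `K = 1` (tree `realRootLawAt_one`),
`K = 2`: Descartes gives `2·C(m+1,m) − 1 = 2m + 1` — the row's value, so the row is Descartes-SHARP at `K = 2`
and the first informative instance of the row is `K = 3` (`η(m,3) ≤ 4m+1` vs Descartes `m²+3m+1`). -/
theorem hyperbolicLinearLaw_of_le_two (m K : ℕ) (hK : K ≤ 2) : HypRootLawAt m K (2 * m * (K - 1) + 1) := by
  rcases (by omega : K = 0 ∨ K = 1 ∨ K = 2) with rfl | rfl | rfl
  · exact hypRootLawAt_zero m _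
  · exact hypRootLawAt_mono (B := 1) (hypRootLawAt_of_realRootLawAt (Summit.ValiantsHypothesis.ValiantsHypothesis.Theorems.LacunarySymmetroidMatrixDescartes.Census.realRootLawAt_one m)) (by omega)
  · refine hypRootLawAt_mono (hypRootLawAt_descartes m 2 (by norm_num)) ?_
    have h : Nat.choose (m + 2 - 1) m = m + 1 := by
      rw [show m + 2 - 1 = m + 1 by omega]
      exact Nat.choose_succ_self_right m
    rw [h]
    omega

end Summit.ValiantsHypothesis.ValiantsHypothesis.Theses.LacunarySymmetroid.HyperbolicLine

end
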